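import Summits.RiemannHypothesis.RiemannHypothesis.Theorems.IntegerScrewCensusDualTerm

/-!
# Route `IntegerScrew` — kernel checker for the census DUAL certificates (10): soundness of one cell

The analytic hypotheses of a cell (`CellHyp`: node-value errors `‖ẑ_a − 2^52 e^{it₀ν_a}‖ ≤ 2^52·15U`, the log-table
bracket `φ_a/2^52 ≤ ν_a ≤ (φ_a+16W)/2^52`, monotone `φ`, `ν`, and the caps `2φ_a/2^52, 2ν_a ≤ c₁`), the trigonometric sum
`qSum` (`Q_Z(t) − C0` and its derivatives), and the three MODEL BOUNDS of a cell: the cell polynomial and its two formal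
derivatives are below `K0·(truth) + ΣA·(unit error)` (`cell_value`, `cell_deriv`, `cell_deriv2`), plus the summed cubic
Taylor step (`qSum_step`).  RH-free; nothing here bears on the truth of RH.
-/

set_option linter.dupNamespace false
set_option autoImplicit false

namespace Summit.RiemannHypothesis.RiemannHypothesis.Theorems.IntegerScrew.Manifest.Fast

open Finset Complex

/-! ### The sums of a certificate -/

/-- The oscillating part of `Q_Z` against a kernel `g`: `Σ_{a<n} (Σ_{b<a} 2Z_ab·g(ν_a − ν_b) + A_a·g(ν_a))`, `A_a = −2·rowsum_a`
(`g = cos(t·)` gives `Q_Z(t) − C0`; `g = −(·)sin(t·)`, `−(·)²cos(t·)` its `t`-derivatives). -/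
noncomputable def qSum (Z : List (List ℤ)) (ν : ℕ → ℝ) (g : ℝ → ℝ) : ℝ :=
  ∑ a ∈ range Z.length, (∑ b ∈ range a, 2 * (((Z.getD a []).getD b 0 : ℤ) : ℝ) * g (ν a - ν b) +
    -2 * (sumZ (Z.getD a []) : ℝ) * g (ν a))

/-- The amplitude sum `ΣA = Σ_a (2|rowsum_a| + Σ_{b<a} 2|Z_ab|)`. -/
noncomputable def ampA (Z : List (List ℤ)) : ℝ :=
  ∑ a ∈ range Z.length, (2 * |(sumZ (Z.getD a []) : ℝ)| + ∑ b ∈ range a, 2 * |(((Z.getD a []).getD b 0 : ℤ) : ℝ)|)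

/-- The cubic amplitude sum `Σ_f |A_f|·|ν_f|³`. -/
noncomputable def ampC (Z : List (List ℤ)) (ν : ℕ → ℝ) : ℝ :=
  ∑ a ∈ range Z.length, (2 * |(sumZ (Z.getD a []) : ℝ)| * |ν a| ^ 3 +
    ∑ b ∈ range a, 2 * |(((Z.getD a []).getD b 0 : ℤ) : ℝ)| * |ν a - ν b| ^ 3)

/-- The ANALYTIC HYPOTHESES of a cell with centre `t₀`: square `Z` inside the lists, node-value errors `15U` (`225U ≤ 1`),
the log-table bracket of the true frequencies `ν_a` (width `16W/2^52`), monotone `φ` and `ν`, and the caps `≤ c₁`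
(a bundle of hypotheses of the soundness theorem, not a cited fact). [folklore] -/
def CellHyp (Z : List (List ℤ)) (φs : List ℕ) (xys : List (ℤ × ℤ)) (ν : ℕ → ℝ) (t0 U c1 : ℝ) (Wm : ℕ) : Prop :=
  (∀ row ∈ Z, row.length = Z.length) ∧ Z.length ≤ φs.length ∧ Z.length ≤ xys.length ∧
    (∀ a, a < Z.length → ‖zh xys a - 2 ^ 52 * exp (I * ((t0 * ν a : ℝ) : ℂ))‖ ≤ 2 ^ 52 * (15 * U)) ∧ 0 ≤ U ∧ 225 * U ≤ 1 ∧
    (∀ a, a < Z.length → (φs.getD a 0 : ℝ) / 2 ^ 52 ≤ ν a ∧ ν a ≤ ((φs.getD a 0 : ℝ) + 16 * Wm) / 2 ^ 52) ∧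
    (∀ a, a < Z.length → ∀ b, b < a → φs.getD b 0 ≤ φs.getD a 0) ∧ (∀ a, a < Z.length → ∀ b, b < a → ν b ≤ ν a) ∧
    (∀ a, a < Z.length → 0 ≤ ν a) ∧ (∀ a, a < Z.length → 2 * (φs.getD a 0 : ℝ) / 2 ^ 52 ≤ c1) ∧
    (∀ a, a < Z.length → 2 * ν a ≤ c1)

namespace CellHyp

variable {Z : List (List ℤ)} {φs : List ℕ} {xys : List (ℤ × ℤ)} {ν : ℕ → ℝ} {t0 U c1 : ℝ} {Wm : ℕ}
  (H : CellHyp Z φs xys ν t0 U c1 Wm)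
include H

/-- `Z` is square. -/
theorem sq : ∀ row ∈ Z, row.length = Z.length := H.1
/-- enough `φ`'s. -/
theorem φlen : Z.length ≤ φs.length := H.2.1
/-- enough node values. -/
theorem xlen : Z.length ≤ xys.length := H.2.2.1
/-- node-value errors. -/
theorem zerr : ∀ a, a < Z.length → ‖zh xys a - 2 ^ 52 * exp (I * ((t0 * ν a : ℝ) : ℂ))‖ ≤ 2 ^ 52 * (15 * U) := H.2.2.2.1
/-- `U ≥ 0`. -/
theorem U0 : 0 ≤ U := H.2.2.2.2.1
/-- `225U ≤ 1`. -/
theorem U225 : 225 * U ≤ 1 := H.2.2.2.2.2.1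
/-- the log-table bracket. -/
theorem tab : ∀ a, a < Z.length → (φs.getD a 0 : ℝ) / 2 ^ 52 ≤ ν a ∧ ν a ≤ ((φs.getD a 0 : ℝ) + 16 * Wm) / 2 ^ 52 :=
  H.2.2.2.2.2.2.1
/-- `φ` monotone. -/
theorem φmono : ∀ a, a < Z.length → ∀ b, b < a → φs.getD b 0 ≤ φs.getD a 0 := H.2.2.2.2.2.2.2.1
/-- `ν` monotone. -/
theorem νmono : ∀ a, a < Z.length → ∀ b, b < a → ν b ≤ ν a := H.2.2.2.2.2.2.2.2.1
/-- `ν ≥ 0`. -/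
theorem ν0 : ∀ a, a < Z.length → 0 ≤ ν a := H.2.2.2.2.2.2.2.2.2.1
/-- cap on `φ`. -/
theorem φc : ∀ a, a < Z.length → 2 * (φs.getD a 0 : ℝ) / 2 ^ 52 ≤ c1 := H.2.2.2.2.2.2.2.2.2.2.1
/-- cap on `ν`. -/
theorem νc : ∀ a, a < Z.length → 2 * ν a ≤ c1 := H.2.2.2.2.2.2.2.2.2.2.2

end CellHyp

/-! ### The generic cell bound -/

/-- **The model sum of a cell is below `K·qSum + ΣA·e`** whenever every term obeys a one-term estimate with unit error `e`. -/
theorem cell_sum_bound {Z : List (List ℤ)} {φs : List ℕ} {xys : List (ℤ × ℤ)} {ν : ℕ → ℝ} {t0 U c1 : ℝ} {Wm : ℕ}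
    (H : CellHyp Z φs xys ν t0 U c1 Wm) (S : ℕ → ℂ) (g : ℝ → ℝ) {K e : ℝ}
    (hterm : ∀ (A : ℤ) (φ : ℕ) (μ : ℝ) (ζh : ℂ), ‖ζh - (2 ^ 104 : ℂ) * exp (I * ((t0 * μ : ℝ) : ℂ))‖ ≤ 2 ^ 104 * (31 * U) →
      ‖ζh‖ ≤ 2 ^ 105 → |2 * (φ : ℝ) / 2 ^ 52 - 2 * μ| ≤ (Wm : ℝ) / 2 ^ 46 → 2 * (φ : ℝ) / 2 ^ 52 ≤ c1 → 2 * |μ| ≤ c1 →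
      |(((A : ℤ) : ℂ) * (ζh * S φ)).re - K * A * g μ| ≤ |(A : ℝ)| * e) :
    (∑ a ∈ range Z.length, ∑ b ∈ range a, (2 * ((Z.getD a []).getD b 0 : ℤ) : ℂ) * (zh xys a * (starRingEnd ℂ) (zh xys b)) *
          S (φs.getD a 0 - φs.getD b 0) +
      ∑ a ∈ range Z.length, ((-2 * sumZ (Z.getD a []) * ((SCL : ℕ) : ℤ) : ℤ) : ℂ) * zh xys a * S (φs.getD a 0)).re ≤
      K * qSum Z ν g + ampA Z * e := by
  rw [Complex.add_re, Complex.re_sum, Complex.re_sum]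
  unfold qSum ampA
  rw [Finset.mul_sum, Finset.sum_mul, ← Finset.sum_add_distrib, ← Finset.sum_add_distrib]
  refine Finset.sum_le_sum fun a ha => ?_
  rw [Finset.mem_range] at ha
  rw [Complex.re_sum, mul_add, Finset.mul_sum, add_mul, Finset.sum_mul]
  have hea : ∀ x : ℝ, ‖exp (I * ((t0 * x : ℝ) : ℂ))‖ = 1 := fun x => Complex.norm_exp_I_mul_ofReal _
  obtain ⟨hta1, hta2⟩ := H.tab a ha
  -- the node term
  have hN : ((((-2 * sumZ (Z.getD a []) * ((SCL : ℕ) : ℤ) : ℤ) : ℂ) * zh xys a * S (φs.getD a 0))).re ≤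
      K * (-2 * (sumZ (Z.getD a []) : ℝ) * g (ν a)) + 2 * |(sumZ (Z.getD a []) : ℝ)| * e := by
    obtain ⟨h1, h2⟩ := node_phasor H.U0 H.U225 (hea (ν a)) (H.zerr a ha)
    have h := hterm (-2 * sumZ (Z.getD a [])) (φs.getD a 0) (ν a) (((SCL : ℕ) : ℂ) * zh xys a) h1 h2
      (by rw [abs_le]; constructor <;> nlinarith) (H.φc a ha) (by rw [abs_of_nonneg (H.ν0 a ha)]; exact H.νc a ha)
    rw [show ((((-2 * sumZ (Z.getD a []) * ((SCL : ℕ) : ℤ) : ℤ) : ℂ) * zh xys a * S (φs.getD a 0))) =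
      (((-2 * sumZ (Z.getD a []) : ℤ) : ℂ) * ((((SCL : ℕ) : ℂ) * zh xys a) * S (φs.getD a 0))) by push_cast; ring]
    have habs : |((-2 * sumZ (Z.getD a []) : ℤ) : ℝ)| * e = 2 * |(sumZ (Z.getD a []) : ℝ)| * e := by
      push_cast; rw [abs_mul, abs_neg, abs_two]
    have hK : K * ((-2 * sumZ (Z.getD a []) : ℤ) : ℝ) * g (ν a) = K * (-2 * (sumZ (Z.getD a []) : ℝ) * g (ν a)) := by
      push_cast; ring
    have := (abs_le.1 h).2
    linarith
  -- the pair terms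
  have hP : ∀ b ∈ range a, ((2 * ((Z.getD a []).getD b 0 : ℤ) : ℂ) * (zh xys a * (starRingEnd ℂ) (zh xys b)) *
      S (φs.getD a 0 - φs.getD b 0)).re ≤
      K * (2 * (((Z.getD a []).getD b 0 : ℤ) : ℝ) * g (ν a - ν b)) + 2 * |(((Z.getD a []).getD b 0 : ℤ) : ℝ)| * e := by
    intro b hb
    rw [Finset.mem_range] at hb
    have hb' : b < Z.length := hb.trans ha
    obtain ⟨htb1, htb2⟩ := H.tab b hb'
    obtain ⟨h1, h2⟩ := pair_phasor H.U0 H.U225 (hea (ν a)) (hea (ν b)) (H.zerr a ha) (H.zerr b hb')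
    rw [conj_expI, expI_mul, show t0 * ν a + -(t0 * ν b) = t0 * (ν a - ν b) by ring] at h1
    have hφab := H.φmono a ha b hb
    have hcast : ((φs.getD a 0 - φs.getD b 0 : ℕ) : ℝ) = (φs.getD a 0 : ℝ) - (φs.getD b 0 : ℝ) := by
      rw [Nat.cast_sub hφab]
    have hνab := H.νmono a ha b hb
    have h := hterm (2 * (Z.getD a []).getD b 0) (φs.getD a 0 - φs.getD b 0) (ν a - ν b)
      (zh xys a * (starRingEnd ℂ) (zh xys b)) h1 h2
      (by rw [hcast, abs_le]; constructor <;> linarith)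
      (by rw [hcast]; linarith [H.φc a ha, show (0 : ℝ) ≤ φs.getD b 0 from Nat.cast_nonneg _])
      (by rw [abs_of_nonneg (sub_nonneg.2 hνab)]; linarith [H.νc a ha, H.ν0 b hb'])
    rw [show (2 * ((Z.getD a []).getD b 0 : ℤ) : ℂ) * (zh xys a * (starRingEnd ℂ) (zh xys b)) * S (φs.getD a 0 - φs.getD b 0) =
      ((2 * (Z.getD a []).getD b 0 : ℤ) : ℂ) * ((zh xys a * (starRingEnd ℂ) (zh xys b)) * S (φs.getD a 0 - φs.getD b 0)) by
        push_cast; ring]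
    have habs : |((2 * (Z.getD a []).getD b 0 : ℤ) : ℝ)| * e = 2 * |(((Z.getD a []).getD b 0 : ℤ) : ℝ)| * e := by
      push_cast; rw [abs_mul, abs_two]
    have hK : K * ((2 * (Z.getD a []).getD b 0 : ℤ) : ℝ) * g (ν a - ν b) =
        K * (2 * (((Z.getD a []).getD b 0 : ℤ) : ℝ) * g (ν a - ν b)) := by
      push_cast; ring
    have := (abs_le.1 h).2
    linarith
  have hPs := Finset.sum_le_sum hP
  rw [Finset.sum_add_distrib] at hPs
  linarith

/-! ### The three model bounds of a cell -/

/-- **Cell value bound**: `G(σ) ≤ K0·(C0 + qSum cos((t₀+2σ)·)) + ΣA·e₀`. -/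
theorem cell_value {D' E : ℕ} {Z : List (List ℤ)} {φs : List ℕ} {xys : List (ℤ × ℤ)} {ν : ℕ → ℝ} {t0 U c1 : ℝ} {Wm : ℕ}
    (H : CellHyp Z φs xys ν t0 U c1 Wm) (hc1 : c1 ≤ ((D' : ℝ) + 1) / 2)
    (hdig : ∀ k, k < D' + 1 + 1 → |dRE (kConsts (D' + 1) E) Z φs xys k| < 2 ^ (SW - 1) ∧ |dIM (kConsts (D' + 1) E) Z φs xys k| < 2 ^ (SW - 1))
    {σ : ℝ} (hσ : |σ| ≤ 1) :
    evalZ (gList (D' + 1) (halfPack (D' + 1)) (accNodes xys (nodeData (kConsts (D' + 1) E) Z φs) xys)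
        (constQ Z * ((K0N (D' + 1) E : ℕ) : ℤ))) σ ≤
      (K0N (D' + 1) E : ℝ) * ((constQ Z : ℝ) + qSum Z ν fun μ => Real.cos ((t0 + 2 * σ) * μ)) +
        ampA Z * ((K0N (D' + 1) E : ℝ) * (31 * U * (1 + 2 * c1 ^ D' / (D').factorial) + 2 * c1 ^ D' / (D').factorial +
          (Wm : ℝ) / 2 ^ 46) + ((D' : ℝ) + 2) * 2 ^ 105) := by
  rw [model_eq Z φs xys _ H.sq H.φlen H.xlen (fun k hk => (hdig k hk).1) (fun k hk => (hdig k hk).2) σ]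
  have h := cell_sum_bound H (fun φ => wSer (kConsts (D' + 1) E) φ σ) (fun μ => Real.cos ((t0 + 2 * σ) * μ))
    (K := (K0N (D' + 1) E : ℝ)) (fun A φ μ ζh h1 h2 h3 h4 h5 => term_value (E := E) (A := A) H.U0 h1 h2 h3 h4 hc1 hσ)
  have hc : (((constQ Z * ((K0N (D' + 1) E : ℕ) : ℤ) : ℤ)) : ℝ) = (K0N (D' + 1) E : ℝ) * (constQ Z : ℝ) := by
    push_cast; ring
  rw [hc]
  linarith

/-- **Cell first-derivative bound**: `G′(σ) ≤ K0·2·qSum(−(·)sin((t₀+2σ)·)) + ΣA·e₁`. -/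
theorem cell_deriv {D' E : ℕ} {Z : List (List ℤ)} {φs : List ℕ} {xys : List (ℤ × ℤ)} {ν : ℕ → ℝ} {t0 U c1 : ℝ} {Wm : ℕ}
    (H : CellHyp Z φs xys ν t0 U c1 Wm) (hc1 : c1 ≤ ((D' : ℝ) + 1) / 2)
    (hdig : ∀ k, k < D' + 1 + 1 → |dRE (kConsts (D' + 1) E) Z φs xys k| < 2 ^ (SW - 1) ∧ |dIM (kConsts (D' + 1) E) Z φs xys k| < 2 ^ (SW - 1))
    {σ : ℝ} (hσ : |σ| ≤ 1) :
    evalZ (derivZ (gList (D' + 1) (halfPack (D' + 1)) (accNodes xys (nodeData (kConsts (D' + 1) E) Z φs) xys)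
        (constQ Z * ((K0N (D' + 1) E : ℕ) : ℤ)))) σ ≤
      (K0N (D' + 1) E : ℝ) * (2 * qSum Z ν fun μ => -μ * Real.sin ((t0 + 2 * σ) * μ)) +
        ampA Z * ((K0N (D' + 1) E : ℝ) * (c1 * (31 * U * (1 + 2 * c1 ^ D' / (D').factorial) + 2 * c1 ^ D' / (D').factorial) +
          (Wm : ℝ) / 2 ^ 46 * (1 + c1)) + ((D' : ℝ) + 2) ^ 2 * 2 ^ 105) := by
  rw [model1_eq Z φs xys _ H.sq H.φlen H.xlen (fun k hk => (hdig k hk).1) (fun k hk => (hdig k hk).2) σ]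
  have h := cell_sum_bound H (fun φ => wSer1 (kConsts (D' + 1) E) φ σ) (fun μ => -(2 * μ) * Real.sin ((t0 + 2 * σ) * μ))
    (K := (K0N (D' + 1) E : ℝ)) (fun A φ μ ζh h1 h2 h3 h4 h5 => term_deriv (E := E) (A := A) H.U0 h1 h2 h3 h4 h5 hc1 hσ)
  have hq : (qSum Z ν fun μ => -(2 * μ) * Real.sin ((t0 + 2 * σ) * μ)) = 2 * qSum Z ν fun μ => -μ * Real.sin ((t0 + 2 * σ) * μ) := by
    unfold qSum; rw [Finset.mul_sum]
    refine Finset.sum_congr rfl fun a _ => ?_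
    rw [mul_add, Finset.mul_sum]
    congr 1
    · exact Finset.sum_congr rfl fun b _ => by ring
    · ring
  rw [hq] at h
  linarith

/-- **Cell second-derivative bound**: `G″(σ) ≤ K0·4·qSum(−(·)²cos((t₀+2σ)·)) + ΣA·e₂`. -/
theorem cell_deriv2 {D' E : ℕ} {Z : List (List ℤ)} {φs : List ℕ} {xys : List (ℤ × ℤ)} {ν : ℕ → ℝ} {t0 U c1 : ℝ} {Wm : ℕ}
    (H : CellHyp Z φs xys ν t0 U c1 Wm) (hc1 : c1 ≤ ((D' : ℝ) + 1) / 2)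
    (hdig : ∀ k, k < D' + 1 + 1 → |dRE (kConsts (D' + 1) E) Z φs xys k| < 2 ^ (SW - 1) ∧ |dIM (kConsts (D' + 1) E) Z φs xys k| < 2 ^ (SW - 1))
    {σ : ℝ} (hσ : |σ| ≤ 1) :
    evalZ (derivZ (derivZ (gList (D' + 1) (halfPack (D' + 1)) (accNodes xys (nodeData (kConsts (D' + 1) E) Z φs) xys)
        (constQ Z * ((K0N (D' + 1) E : ℕ) : ℤ))))) σ ≤
      (K0N (D' + 1) E : ℝ) * (4 * qSum Z ν fun μ => -μ ^ 2 * Real.cos ((t0 + 2 * σ) * μ)) +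
        ampA Z * ((K0N (D' + 1) E : ℝ) * (c1 ^ 2 * (31 * U * (1 + 2 * c1 ^ D' / (D').factorial) + 2 * c1 ^ D' / (D').factorial) +
          (Wm : ℝ) / 2 ^ 46 * (2 * c1 + c1 ^ 2)) + ((D' : ℝ) + 3) ^ 3 * 2 ^ 105) := by
  rw [model2_eq Z φs xys _ H.sq H.φlen H.xlen (fun k hk => (hdig k hk).1) (fun k hk => (hdig k hk).2) (by omega) σ]
  have h := cell_sum_bound H (fun φ => wSer2 (kConsts (D' + 1) E) φ σ) (fun μ => -(2 * μ) ^ 2 * Real.cos ((t0 + 2 * σ) * μ))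
    (K := (K0N (D' + 1) E : ℝ)) (fun A φ μ ζh h1 h2 h3 h4 h5 => term_deriv2 (E := E) (A := A) H.U0 h1 h2 h3 h4 h5 hc1 hσ)
  have hq : (qSum Z ν fun μ => -(2 * μ) ^ 2 * Real.cos ((t0 + 2 * σ) * μ)) =
      4 * qSum Z ν fun μ => -μ ^ 2 * Real.cos ((t0 + 2 * σ) * μ) := by
    unfold qSum; rw [Finset.mul_sum]
    refine Finset.sum_congr rfl fun a _ => ?_
    rw [mul_add, Finset.mul_sum]
    congr 1
    · exact Finset.sum_congr rfl fun b _ => by ring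
    · ring
  rw [hq] at h
  linarith

/-! ### The summed cubic Taylor step -/

/-- **One-sided cubic step of the true sum** in the walk variable `s` (`t = c + 4s`): for `0 ≤ u ≤ 1/16` and all `|ν_f| ≤ 8`,
`Q(s+u) ≥ Q(s) + 4Q₁(s)u + 16Q₂(s)u²/2 − (64/3)·ampC·u³`. -/
theorem qSum_step {Z : List (List ℤ)} {ν : ℕ → ℝ} (hν8 : ∀ a, a < Z.length → |ν a| ≤ 8)
    (hνmono : ∀ a, a < Z.length → ∀ b, b < a → ν b ≤ ν a) (hν0 : ∀ a, a < Z.length → 0 ≤ ν a)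
    (cc s : ℝ) {u : ℝ} (hu0 : 0 ≤ u) (hu : u ≤ 1 / 16) :
    (qSum Z ν fun μ => Real.cos ((cc + 4 * s) * μ)) + (4 * qSum Z ν fun μ => -μ * Real.sin ((cc + 4 * s) * μ)) * u +
        (16 * qSum Z ν fun μ => -μ ^ 2 * Real.cos ((cc + 4 * s) * μ)) / 2 * u ^ 2 - (64 / 3) * ampC Z ν * u ^ 3 ≤
      qSum Z ν fun μ => Real.cos ((cc + 4 * (s + u)) * μ) := by
  unfold qSum ampC
  have hstep : ∀ (A μ : ℝ), |μ| ≤ 8 → A * Real.cos ((cc + 4 * s) * μ) + 4 * (A * (-μ * Real.sin ((cc + 4 * s) * μ))) * u +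
      16 * (A * (-μ ^ 2 * Real.cos ((cc + 4 * s) * μ))) / 2 * u ^ 2 - (64 / 3) * (|A| * |μ| ^ 3) * u ^ 3 ≤
      A * Real.cos ((cc + 4 * (s + u)) * μ) := by
    intro A μ hμ
    have := term_step (A := A) (cc := cc) (s := s) hμ hu0 hu
    nlinarith [this]
  have hsum : ∀ (a : ℕ), a < Z.length →
      (∑ b ∈ range a, 2 * (((Z.getD a []).getD b 0 : ℤ) : ℝ) * Real.cos ((cc + 4 * s) * (ν a - ν b)) +
          -2 * (sumZ (Z.getD a []) : ℝ) * Real.cos ((cc + 4 * s) * ν a)) +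
        4 * (∑ b ∈ range a, 2 * (((Z.getD a []).getD b 0 : ℤ) : ℝ) * (-(ν a - ν b) * Real.sin ((cc + 4 * s) * (ν a - ν b))) +
          -2 * (sumZ (Z.getD a []) : ℝ) * (-ν a * Real.sin ((cc + 4 * s) * ν a))) * u +
        16 * (∑ b ∈ range a, 2 * (((Z.getD a []).getD b 0 : ℤ) : ℝ) * (-(ν a - ν b) ^ 2 * Real.cos ((cc + 4 * s) * (ν a - ν b))) +
          -2 * (sumZ (Z.getD a []) : ℝ) * (-ν a ^ 2 * Real.cos ((cc + 4 * s) * ν a))) / 2 * u ^ 2 -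
        (64 / 3) * (2 * |(sumZ (Z.getD a []) : ℝ)| * |ν a| ^ 3 +
          ∑ b ∈ range a, 2 * |(((Z.getD a []).getD b 0 : ℤ) : ℝ)| * |ν a - ν b| ^ 3) * u ^ 3 ≤
      ∑ b ∈ range a, 2 * (((Z.getD a []).getD b 0 : ℤ) : ℝ) * Real.cos ((cc + 4 * (s + u)) * (ν a - ν b)) +
        -2 * (sumZ (Z.getD a []) : ℝ) * Real.cos ((cc + 4 * (s + u)) * ν a) := by
    intro a ha
    have hn := hstep (-2 * (sumZ (Z.getD a []) : ℝ)) (ν a) (hν8 a ha)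
    rw [show |-2 * (sumZ (Z.getD a []) : ℝ)| = 2 * |(sumZ (Z.getD a []) : ℝ)| by rw [abs_mul, abs_neg, abs_two]] at hn
    have hp : ∀ b ∈ range a, 2 * (((Z.getD a []).getD b 0 : ℤ) : ℝ) * Real.cos ((cc + 4 * s) * (ν a - ν b)) +
        4 * (2 * (((Z.getD a []).getD b 0 : ℤ) : ℝ) * (-(ν a - ν b) * Real.sin ((cc + 4 * s) * (ν a - ν b)))) * u +
        16 * (2 * (((Z.getD a []).getD b 0 : ℤ) : ℝ) * (-(ν a - ν b) ^ 2 * Real.cos ((cc + 4 * s) * (ν a - ν b)))) / 2 * u ^ 2 -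
        (64 / 3) * (2 * |(((Z.getD a []).getD b 0 : ℤ) : ℝ)| * |ν a - ν b| ^ 3) * u ^ 3 ≤
        2 * (((Z.getD a []).getD b 0 : ℤ) : ℝ) * Real.cos ((cc + 4 * (s + u)) * (ν a - ν b)) := by
      intro b hb
      rw [Finset.mem_range] at hb
      have hμ : |ν a - ν b| ≤ 8 := by
        rw [abs_of_nonneg (sub_nonneg.2 (hνmono a ha b hb))]
        have := hν8 a ha; rw [abs_of_nonneg (hν0 a ha)] at this
        linarith [hν0 b (hb.trans ha)]
      have := hstep (2 * (((Z.getD a []).getD b 0 : ℤ) : ℝ)) (ν a - ν b) hμ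
      rw [show |2 * (((Z.getD a []).getD b 0 : ℤ) : ℝ)| = 2 * |(((Z.getD a []).getD b 0 : ℤ) : ℝ)| by rw [abs_mul, abs_two]] at this
      exact this
    have hps := Finset.sum_le_sum hp
    rw [Finset.sum_sub_distrib, Finset.sum_add_distrib, Finset.sum_add_distrib, ← Finset.sum_mul, ← Finset.sum_mul,
      ← Finset.sum_mul, ← Finset.sum_div, ← Finset.mul_sum, ← Finset.mul_sum, ← Finset.mul_sum] at hps
    nlinarith [hps, hn]
  have htot := Finset.sum_le_sum fun a ha => hsum a (Finset.mem_range.1 ha)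
  rw [Finset.sum_sub_distrib, Finset.sum_add_distrib, Finset.sum_add_distrib, ← Finset.sum_mul, ← Finset.sum_mul,
    ← Finset.sum_mul, ← Finset.sum_div, ← Finset.mul_sum, ← Finset.mul_sum, ← Finset.mul_sum] at htot
  linarith

end Summit.RiemannHypothesis.RiemannHypothesis.Theorems.IntegerScrew.Manifest.Fast
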